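import Summits.QuantumFields.BalabanUV.Beta.S0NOfReflection
import Summits.QuantumFields.BalabanUV.Beta.E3ContactFactor

/-!
# `BalabanUV.Beta.ReflectionLocusSymShift` — binder row D1, RULING R-D1-g28-2 FILE E5: THE (Sr-conj) LETTER OF THE (0.4) LITERAL AT EVERY LEVEL, BY
# INDUCTION, against the shifted straight spread `bhKStepSh Dsh j` with the border-reading generator `γ j • diagK (ctGenM (bhK + Dsh) α Lc κ u)` —
# from the table letters (V-r)(V-ff0)(H-r) and the shift letters (Dspr)(Dnull)(Dff)(Dmm)(DG); level 0 by `S0NOfReflection.S0NOf_bref`, the step by the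
# chart-free contact law `E3ContactFactor.e3OfK_Gsym_bref_inl_inl_of_law` + `StepReflectionRecSlot.SrecOf_succ_bref_of_e3Law`, the units locks from the pin
# `cE = Lc^{d+1}` (the SAME pin as the Ward binder; twin of `SpineRecursiveInductive`∕`SpineRecursiveClosed` for the comb)

HONEST FRAMING (cell charter, verbatim): «discharging BetaPertH makes Balaban's UV stability UNCONDITIONAL — a real constructive-QFT result; it is
NOT the continuum limit and NOT the Clay problem.»  HONEST DEPENDENCY: continuum YM on T⁴ ⇐ BetaPertH ∧ nine spine estimates (0/9 proved); BetaPertH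
⇐ (D1) ∧ (D4) ∧ CAP+tail; G-an2-4 gates asym, D1 and NE2/3/4.  DERIVED cell leaf (β sub-cell, BINDER-OWNERS row D1 OWNER `b2b-balaban-beta-an2`, gen 28).
WHAT ([folklore]): §1 units (`wVH_zero`, `gamma_zero`, `locks_of_pin`, `pin_of_bcj` — generic `d`, pin `cE = Lc^{d+1}`); §2 the shifted spread
agrees with `stepScale j • (bhK + Dsh)` on the three border leg pairs (`bhKStepSh_fm∕_mf'∕_mm_agree`) and, under (Dff), `mmRead (Gsym j) =ff= (wVH (j+1))⁻¹ •
bhKStepSh Dsh (j+1)` (`mmRead_Gsym_inl_inl_eq`); §3 the primed contact law `e3OfK_Gsym_bref_inl_inl_of_law'` (contact against `bhKStepSh Dsh (j+1)`); §4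
**`hSrC_SrecOf_Gsym_all`**: for odd `Lc`, every slot data `(V, H)` with (V-r)(V-ff0)(H-r), every shift `Dsh` with (Dspr)(Dnull)(Dff)(Dmm)(DG), `2·cVH = −cE·Lc^{d+1}`
and the locks: ∀ j, the (Sr-conj) law of `SrecOf V H Gsym cE cVH cΛ j` against `bhKStepSh d Lc Dsh j` with contact `γ j • diagK (ctGenM d (bhK Lc + Dsh) α Lc κ u)`,
`γ j = cVH·wVH j∕(stepScale j·Lc^{d+1})`; `hSrC_SrecOf_Gsym_all_bcj` (locks discharged at the pin); §5 `d + 1 = 4`: **`hSrC_SsymOf_all`**, **`hSrC_JsB12Sym0`** — the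
hypothesis hSrC of the row's END at the literal (`RowD1JointEndSym.d1Drift_JsB12Sym_of_shiftLetters_D1Tel_D1Rep`) with `C j α κ u := γ j • diagK (ctGenM 3 (bhK Lc + Dsh) α Lc κ u)`,
`γ j = −(Lc⁴∕2)·wVH 3 Lc j∕stepScale 3 Lc j`.
HONEST: (Sr-conj) is REDUCED to letters about an1's table VALUES and the displayed shift — (V-r)(V-ff0)(H-r)(Dspr)(Dnull)(Dff)(Dmm)(DG) are HYPOTHESES, proved by
nobody; root-level classes 0∕5 discharged; tables 0∕5; NOT D1, NOT `BetaPertH`, NOT continuum, NOT Clay.  No statement of Bałaban's papers, no `[cite:]`, no `Prop`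
fact, no `def`.  Provenance: β sub-cell, unit beta-an2 gen 28, 2026-08-21 (v1); over E1–E4 and the files named above BY NAME; no existing file touched.
-/

open Finset
open scoped BigOperators
open Literature.Probability.LatticeModels (Torus.proj)
open Literature.MathematicalPhysics.QuantumFieldTheory
open Literature.MathematicalPhysics.QuantumFieldTheory.Balaban1983to89
open Literature.MathematicalPhysics.QuantumFieldTheory.Balaban1983to89.Beta
open ExpKernelCalculus (MKer comp VertexFamily)
open PolarizationSign (reflSign)
open KernelReflection (refK refK_apply)
open ResolventReflection (bref Φ)
open OneStepResolventKernel (Fib LocStencil)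
open OneStepKernelFamily (KInvStep)
open BalabanStepJetsSucc (mmRead mmRead_inl_inl E2 wE wVH)
open AveragingContoursRooted (ctr ctrOff ctrOff_mem_box)
open Summit.QuantumFields.BalabanUV.Beta.TameKernelCalculus
open Summit.QuantumFields.BalabanUV.Beta.ChartConjugation (conjV)
open Summit.QuantumFields.BalabanUV.Beta.AxialDressingRooted (one_le_of_neZero)
open Summit.QuantumFields.BalabanUV.Beta.BorderedHessian (bhK bhK_inr_inr bhKStep bhKStep_zero bhKStep_succ_inl_inl bhKStep_succ_inl_inr stepScale
  stepScale_ne_zero diagK conjV_diagK_apply)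
open Summit.QuantumFields.BalabanUV.Beta.SymSliceProjectorKernel (symEc)
open Summit.QuantumFields.BalabanUV.Beta.SpineRooted (e3OfK S0NOf locStencil_SrecOf)
open Summit.QuantumFields.BalabanUV.Beta.WardLocusRecursive (SrecOf SrecOf_zero)
open Summit.QuantumFields.BalabanUV.Beta.WardLocusInduction (wVH_eq_stepScale_sq wE_eq_stepScale_cube)
open Summit.QuantumFields.BalabanUV.Beta.KernelWardLevels (stepScale_zero)
open Summit.QuantumFields.BalabanUV.Beta.SymmetrisedStepJets (SymTables Gsym Gsym_apply decays_Gsym SsymOf SsymOf_eq JsB12Sym0 JsB12Sym0_eq JsSym0Of_S)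
open Summit.QuantumFields.BalabanUV.Beta.SymShiftedSpread (bhKStepSh bhKStepSh_apply bhKStepSh_zero mmRead_Gsym)
open Summit.QuantumFields.BalabanUV.Beta.E3CoDressedContact (conjV_diagK_inl_inl_of_ff)
open Summit.QuantumFields.BalabanUV.Beta.E3ContactGenerator (ctGenM)
open Summit.QuantumFields.BalabanUV.Beta.E3ContactFactor (bhKStep_mf_uniform bhKStep_mm_zero bhKStepSh_mf e3OfK_Gsym_bref_inl_inl_of_law)
open Summit.QuantumFields.BalabanUV.Beta.StepReflectionRecSlot (SrecOf_succ_bref_of_e3Law)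
open Summit.QuantumFields.BalabanUV.Beta.S0NOfReflection (S0NOf_bref)

noncomputable section

namespace Summit.QuantumFields.BalabanUV.Beta.ReflectionLocusSymShift

variable {d : ℕ} {Lc : ℕ} [NeZero Lc]

/-! ## §1 Units -/

omit [NeZero Lc] in
/-- [folklore] `wVH 0 = 1`. -/
theorem wVH_zero : wVH d Lc 0 = 1 := by simp [BalabanStepJetsSucc.wVH]

omit [NeZero Lc] in
/-- [folklore] `γ 0 = cVH / Lc^{d+1}`. -/
theorem gamma_zero (cVH : ℝ) : cVH * wVH d Lc 0 / (stepScale d Lc 0 * (Lc : ℝ) ^ (d + 1)) = cVH / (Lc : ℝ) ^ (d + 1) := by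
  rw [wVH_zero, stepScale_zero, mul_one, one_mul]

/-- [folklore] **THE UNITS LOCKS FROM THE PIN** `∀ j, cE·wE (j+1) = stepScale (j+1)³·Lc^{d+1}` (generic `d`; `wVH = stepScale²`). -/
theorem locks_of_pin (cE cVH : ℝ) (hpin : ∀ j, cE * wE d Lc (j + 1) = stepScale d Lc (j + 1) ^ 3 * (Lc : ℝ) ^ (d + 1)) (j : ℕ) :
    cE * wE d Lc (j + 1) * (cVH * wVH d Lc j / (stepScale d Lc j * (Lc : ℝ) ^ (d + 1)) / (stepScale d Lc j * (Lc : ℝ) ^ (d + 1)) * (wVH d Lc (j + 1))⁻¹) =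
      cVH * wVH d Lc (j + 1) / (stepScale d Lc (j + 1) * (Lc : ℝ) ^ (d + 1)) := by
  have hL : (Lc : ℝ) ≠ 0 := by exact_mod_cast NeZero.ne Lc
  have hs0 : stepScale d Lc j ≠ 0 := stepScale_ne_zero j
  have hs1 : stepScale d Lc (j + 1) ≠ 0 := stepScale_ne_zero (j + 1)
  rw [hpin, wVH_eq_stepScale_sq, wVH_eq_stepScale_sq]
  field_simp

omit [NeZero Lc] in
/-- [folklore] At the tree's numerals (`wE = stepScale³`) the pin reads `cE = Lc^{d+1}`. -/
theorem pin_of_bcj (cE : ℝ) (hcE : cE = (Lc : ℝ) ^ (d + 1)) (j : ℕ) : cE * wE d Lc (j + 1) = stepScale d Lc (j + 1) ^ 3 * (Lc : ℝ) ^ (d + 1) := by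
  rw [hcE, wE_eq_stepScale_cube]; ring

/-! ## §2 The shifted spread agrees with `stepScale j • (bhK + Dsh)` on the border; the `mm`-read dictionary -/

section Border

variable {Dsh : MKer (d + 1) (Fib d)}

/-- [folklore] The straight step candidate has the uniform field–multiplier border scale `stepScale j`. -/
theorem bhKStep_fm_uniform : ∀ (j : ℕ) (x y : Fin (d + 1) → ℤ) (β μ : Fin (d + 1)),
    bhKStep d Lc j x y (Sum.inl β) (Sum.inr μ) = stepScale d Lc j * bhK Lc x y (Sum.inl β) (Sum.inr μ)
  | 0, x, y, β, μ => by rw [bhKStep_zero, stepScale_zero, one_mul]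
  | j + 1, x, y, β, μ => bhKStep_succ_inl_inr j x y β μ

/-- [folklore] Field–multiplier agreement: `bhKStepSh Dsh j =fm= stepScale j • (bhK + Dsh)`. -/
theorem bhKStepSh_fm (j : ℕ) (x y : Fin (d + 1) → ℤ) (β μ : Fin (d + 1)) :
    bhKStepSh d Lc Dsh j x y (Sum.inl β) (Sum.inr μ) = stepScale d Lc j * (bhK (d := d) Lc + Dsh) x y (Sum.inl β) (Sum.inr μ) := by
  rw [bhKStepSh_apply]
  simp only [Pi.add_apply, Pi.smul_apply, smul_eq_mul, bhKStep_fm_uniform]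
  ring

/-- [folklore] Multiplier–multiplier agreement: `bhKStepSh Dsh j =mm= stepScale j • (bhK + Dsh)` (both sides are `stepScale j · Dsh_mm`). -/
theorem bhKStepSh_mm_agree (j : ℕ) (x y : Fin (d + 1) → ℤ) (μ μ' : Fin (d + 1)) :
    bhKStepSh d Lc Dsh j x y (Sum.inr μ) (Sum.inr μ') = stepScale d Lc j * (bhK (d := d) Lc + Dsh) x y (Sum.inr μ) (Sum.inr μ') := by
  rw [bhKStepSh_apply]
  simp only [Pi.add_apply, Pi.smul_apply, smul_eq_mul, bhKStep_mm_zero, bhK_inr_inr]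
  ring

/-- [folklore] **THE `mm`-READ DICTIONARY OF THE SHIFTED SPREAD**: under (Dff) `Dsh_ff = 0`, `mmRead Lc (Gsym Lc j) =ff= (wVH (j+1))⁻¹ · bhKStepSh d Lc Dsh (j+1)`
(`mmRead_Gsym = E2 (j+1)`, `bhKStep (j+1)_ff = wVH (j+1) • E2 (j+1)`). -/
theorem mmRead_Gsym_inl_inl_eq (hDff : ∀ (x z : Fin (d + 1) → ℤ) (β β' : Fin (d + 1)), Dsh x z (Sum.inl β) (Sum.inl β') = 0) (j : ℕ)
    (x z : Fin (d + 1) → ℤ) (a b : Fin (d + 1)) :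
    mmRead Lc (Gsym (d := d) Lc j) x z (Sum.inl a) (Sum.inl b) = (wVH d Lc (j + 1))⁻¹ * bhKStepSh d Lc Dsh (j + 1) x z (Sum.inl a) (Sum.inl b) := by
  rw [mmRead_Gsym, bhKStepSh_apply]
  simp only [Pi.add_apply, Pi.smul_apply, smul_eq_mul, bhKStep_succ_inl_inl, hDff, mul_zero, add_zero]
  have hw : wVH d Lc (j + 1) ≠ 0 := by rw [wVH_eq_stepScale_sq]; exact pow_ne_zero _ (stepScale_ne_zero (j + 1))
  rw [← mul_assoc, inv_mul_cancel₀ hw, one_mul]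

end Border

/-! ## §3 The primed contact law: contact against the next shifted spread -/

section Primed

variable {Dsh : MKer (d + 1) (Fib d)}

/-- [folklore] **THE CUBIC-SECTOR CONTACT LAW WITH THE CONTACT AGAINST `bhKStepSh Dsh (j+1)`**: `E3ContactFactor.e3OfK_Gsym_bref_inl_inl_of_law` + the
`mm`-read dictionary (so (Dff) enters): coefficient `γ · (wVH (j+1))⁻¹ / (stepScale j · Lc^{d+1})`. -/
theorem e3OfK_Gsym_bref_inl_inl_of_law' (hLc : Odd Lc) (j : ℕ) (hD : Spr Dsh) (hDnull : comp (comp (symEc Lc) Dsh) (symEc Lc) = 0)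
    (hDff : ∀ (x z : Fin (d + 1) → ℤ) (β β' : Fin (d + 1)), Dsh x z (Sum.inl β) (Sum.inl β') = 0)
    (hDmm : ∀ (x y : Fin (d + 1) → ℤ) (κ l : Fin (d + 1)), Dsh x y (Sum.inr κ) (Sum.inr l) = 0)
    (hGD : ∀ (x z : Fin (d + 1) → ℤ) (m a : Fin (d + 1)), comp (Gsym (d := d) Lc j) Dsh x z (Sum.inr m) (Sum.inl a) = 0)
    (hDG : ∀ (x z : Fin (d + 1) → ℤ) (a m : Fin (d + 1)), comp Dsh (Gsym (d := d) Lc j) x z (Sum.inl a) (Sum.inr m) = 0)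
    {α : Fin (d + 1)} {S : Fin (d + 1) → (Fin (d + 1) → ℤ) → MKer (d + 1) (Fib d)} {Cs δ : ℝ} (hS : LocStencil S Cs δ) (hδ : 0 < δ) (γ : ℝ)
    (hSr : ∀ κ u, S κ (bref α κ u) =
      reflSign α κ • refK (Φ (d := d) Lc α) (S κ u + conjV (bhKStepSh d Lc Dsh j) (γ • diagK (ctGenM d (bhK Lc + Dsh) α Lc κ u))))
    (κ' : Fin (d + 1)) (u' x z : Fin (d + 1) → ℤ) (a b : Fin (d + 1)) :
    e3OfK Lc (Gsym Lc j) S κ' (bref α κ' u') x z (Sum.inl a) (Sum.inl b) =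
      reflSign α κ' * ((Φ (d := d) Lc α).s (Sum.inl a) * (Φ (d := d) Lc α).s (Sum.inl b) *
        (e3OfK Lc (Gsym Lc j) S κ' u' ((Φ (d := d) Lc α).r (Sum.inl a) x) ((Φ (d := d) Lc α).r (Sum.inl b) z) (Sum.inl a) (Sum.inl b) +
          γ * (wVH d Lc (j + 1))⁻¹ / (stepScale d Lc j * (Lc : ℝ) ^ (d + 1)) *
            conjV (bhKStepSh d Lc Dsh (j + 1)) (diagK (ctGenM d (bhK Lc + Dsh) α Lc κ' u')) ((Φ (d := d) Lc α).r (Sum.inl a) x)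
              ((Φ (d := d) Lc α).r (Sum.inl b) z) (Sum.inl a) (Sum.inl b))) := by
  rw [e3OfK_Gsym_bref_inl_inl_of_law hLc j hD hDnull hDmm hGD hDG hS hδ γ hSr κ' u' x z a b,
    conjV_diagK_inl_inl_of_ff (wVH d Lc (j + 1))⁻¹ (mmRead_Gsym_inl_inl_eq hDff j)]
  ring

end Primed

/-! ## §4 The induction: (Sr-conj) at every level for the slotted family over `Gsym` against the shifted spread -/

section Induction

variable {V H : Fin (d + 1) → (Fin (d + 1) → ℤ) → MKer (d + 1) (Fib d)} {Dsh : MKer (d + 1) (Fib d)}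

/-- [folklore] **(Sr-conj) AT EVERY LEVEL FOR `SrecOf V H Gsym cE cVH cΛ` AGAINST `bhKStepSh Dsh j`, FROM THE LETTERS AND THE LOCKS** (odd `Lc`, generic `d`):
tables (LV)(LH) localised, (V-r) on the three border leg pairs against `bhK + Dsh` with generator `(Lc^{d+1})⁻¹ • diagK (ctGenM d (bhK Lc + Dsh) α Lc κ u)`, (V-ff0),
(H-r); shift (Dspr)(Dnull)(Dff)(Dmm)(DG); normalisation `2·cVH = −cE·Lc^{d+1}`; locks `hlock`.  Conclusion: `∀ j κ u`,
`SrecOf … j κ (bref α κ u) = reflSign α κ • refK (Φ Lc α) (SrecOf … j κ u + conjV (bhKStepSh d Lc Dsh j) (γ j • diagK (ctGenM d (bhK Lc + Dsh) α Lc κ u)))`. -/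
theorem hSrC_SrecOf_Gsym_all (hLc : Odd Lc) (hV : ∀ δ : ℝ, 0 ≤ δ → ∃ C : ℝ, LocStencil V C δ) (hH : ∀ δ : ℝ, 0 ≤ δ → ∃ C : ℝ, VertexFamily H Lc C δ)
    (hD : Spr Dsh) (hDnull : comp (comp (symEc Lc) Dsh) (symEc Lc) = 0)
    (hDff : ∀ (x z : Fin (d + 1) → ℤ) (β β' : Fin (d + 1)), Dsh x z (Sum.inl β) (Sum.inl β') = 0)
    (hDmm : ∀ (x y : Fin (d + 1) → ℤ) (κ l : Fin (d + 1)), Dsh x y (Sum.inr κ) (Sum.inr l) = 0)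
    (hGD : ∀ (j : ℕ) (x z : Fin (d + 1) → ℤ) (m a : Fin (d + 1)), comp (Gsym (d := d) Lc j) Dsh x z (Sum.inr m) (Sum.inl a) = 0)
    (hDG : ∀ (j : ℕ) (x z : Fin (d + 1) → ℤ) (a m : Fin (d + 1)), comp Dsh (Gsym (d := d) Lc j) x z (Sum.inl a) (Sum.inr m) = 0)
    (cE cVH cΛ : ℝ) (hn : 2 * cVH = -(cE * (Lc : ℝ) ^ (d + 1))) (γ : ℕ → ℝ)
    (hγ : ∀ j, γ j = cVH * wVH d Lc j / (stepScale d Lc j * (Lc : ℝ) ^ (d + 1)))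
    (hlock : ∀ j, cE * wE d Lc (j + 1) * (γ j / (stepScale d Lc j * (Lc : ℝ) ^ (d + 1)) * (wVH d Lc (j + 1))⁻¹) = γ (j + 1))
    {α : Fin (d + 1)}
    (hVfm : ∀ (κ' : Fin (d + 1)) (u x z : Fin (d + 1) → ℤ) (β μ : Fin (d + 1)), V κ' (bref α κ' u) x z (Sum.inl β) (Sum.inr μ) =
      (reflSign α κ' • refK (Φ (d := d) Lc α) (V κ' u + conjV (bhK (d := d) Lc + Dsh)
        ((((Lc : ℝ) ^ (d + 1))⁻¹) • diagK (ctGenM d (bhK Lc + Dsh) α Lc κ' u)))) x z (Sum.inl β) (Sum.inr μ))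
    (hVmf : ∀ (κ' : Fin (d + 1)) (u x z : Fin (d + 1) → ℤ) (μ β : Fin (d + 1)), V κ' (bref α κ' u) x z (Sum.inr μ) (Sum.inl β) =
      (reflSign α κ' • refK (Φ (d := d) Lc α) (V κ' u + conjV (bhK (d := d) Lc + Dsh)
        ((((Lc : ℝ) ^ (d + 1))⁻¹) • diagK (ctGenM d (bhK Lc + Dsh) α Lc κ' u)))) x z (Sum.inr μ) (Sum.inl β))
    (hVmm : ∀ (κ' : Fin (d + 1)) (u x z : Fin (d + 1) → ℤ) (μ μ' : Fin (d + 1)), V κ' (bref α κ' u) x z (Sum.inr μ) (Sum.inr μ') =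
      (reflSign α κ' • refK (Φ (d := d) Lc α) (V κ' u + conjV (bhK (d := d) Lc + Dsh)
        ((((Lc : ℝ) ^ (d + 1))⁻¹) • diagK (ctGenM d (bhK Lc + Dsh) α Lc κ' u)))) x z (Sum.inr μ) (Sum.inr μ'))
    (hV0 : ∀ (κ : Fin (d + 1)) (w x z : Fin (d + 1) → ℤ) (β β' : Fin (d + 1)), V κ w x z (Sum.inl β) (Sum.inl β') = 0)
    (hHr : ∀ (α' μ : Fin (d + 1)) (y : Fin (d + 1) → ℤ), H μ (bref α' μ y) = reflSign α' μ • refK (Φ (d := d) Lc α') (H μ y)) :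
    ∀ (j : ℕ) (κ : Fin (d + 1)) (u : Fin (d + 1) → ℤ),
      SrecOf d Lc V H (Gsym Lc) cE cVH cΛ j κ (bref α κ u) =
        reflSign α κ • refK (Φ Lc α) (SrecOf d Lc V H (Gsym Lc) cE cVH cΛ j κ u +
          conjV (bhKStepSh d Lc Dsh j) (γ j • diagK (ctGenM d (bhK Lc + Dsh) α Lc κ u))) := by
  have hB : ∀ (x z : Fin (d + 1) → ℤ) (β β' : Fin (d + 1)), (bhK (d := d) Lc + Dsh) x z (Sum.inl β) (Sum.inl β') = bhK Lc x z (Sum.inl β) (Sum.inl β') :=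
    fun x z β β' => by rw [Pi.add_apply, Pi.add_apply, Pi.add_apply, Pi.add_apply, hDff, add_zero]
  intro j
  induction j with
  | zero =>
    intro κ u
    rw [SrecOf_zero, bhKStepSh_zero, hγ, gamma_zero]
    exact S0NOf_bref cΛ hn hB hVfm hVmf hVmm hV0 hHr κ u
  | succ j ih =>
    intro κ u
    obtain ⟨Cs, δ, hδ, hS⟩ := locStencil_SrecOf (one_le_of_neZero Lc) hV hH (decays_Gsym Lc) cE cVH cΛ j
    have hQ := fun κ' u' x z β β' =>
      e3OfK_Gsym_bref_inl_inl_of_law' hLc j hD hDnull hDff hDmm (hGD j) (hDG j) hS hδ (γ j) ih κ' u' x z β β'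
    have hc : cE * wE d Lc (j + 1) * (γ j * (wVH d Lc (j + 1))⁻¹ / (stepScale d Lc j * (Lc : ℝ) ^ (d + 1))) =
        cVH * wVH d Lc (j + 1) / (stepScale d Lc (j + 1) * (Lc : ℝ) ^ (d + 1)) := by
      rw [show γ j * (wVH d Lc (j + 1))⁻¹ / (stepScale d Lc j * (Lc : ℝ) ^ (d + 1)) =
        γ j / (stepScale d Lc j * (Lc : ℝ) ^ (d + 1)) * (wVH d Lc (j + 1))⁻¹ by ring, hlock, hγ]
    rw [hγ]
    exact SrecOf_succ_bref_of_e3Law (Gsym Lc) cE cVH cΛ j (stepScale_ne_zero (j + 1)) (fun x z β μ => bhKStepSh_fm (j + 1) x z β μ)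
      (fun x z μ β => bhKStepSh_mf (j + 1) x z μ β) (fun x z μ μ' => bhKStepSh_mm_agree (j + 1) x z μ μ') hVfm hVmf hVmm hV0 hHr
      (γ j * (wVH d Lc (j + 1))⁻¹ / (stepScale d Lc j * (Lc : ℝ) ^ (d + 1))) hc hQ κ u

/-- [folklore] **THE SAME WITH THE LOCKS DISCHARGED AT THE PIN `cE = Lc^{d+1}`** (then `2·cVH = −cE·Lc^{d+1}` reads `cVH = −Lc^{2(d+1)}/2`). -/
theorem hSrC_SrecOf_Gsym_all_bcj (hLc : Odd Lc) (hV : ∀ δ : ℝ, 0 ≤ δ → ∃ C : ℝ, LocStencil V C δ) (hH : ∀ δ : ℝ, 0 ≤ δ → ∃ C : ℝ, VertexFamily H Lc C δ)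
    (hD : Spr Dsh) (hDnull : comp (comp (symEc Lc) Dsh) (symEc Lc) = 0)
    (hDff : ∀ (x z : Fin (d + 1) → ℤ) (β β' : Fin (d + 1)), Dsh x z (Sum.inl β) (Sum.inl β') = 0)
    (hDmm : ∀ (x y : Fin (d + 1) → ℤ) (κ l : Fin (d + 1)), Dsh x y (Sum.inr κ) (Sum.inr l) = 0)
    (hGD : ∀ (j : ℕ) (x z : Fin (d + 1) → ℤ) (m a : Fin (d + 1)), comp (Gsym (d := d) Lc j) Dsh x z (Sum.inr m) (Sum.inl a) = 0)
    (hDG : ∀ (j : ℕ) (x z : Fin (d + 1) → ℤ) (a m : Fin (d + 1)), comp Dsh (Gsym (d := d) Lc j) x z (Sum.inl a) (Sum.inr m) = 0)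
    (cΛ : ℝ) {α : Fin (d + 1)}
    (hVfm : ∀ (κ' : Fin (d + 1)) (u x z : Fin (d + 1) → ℤ) (β μ : Fin (d + 1)), V κ' (bref α κ' u) x z (Sum.inl β) (Sum.inr μ) =
      (reflSign α κ' • refK (Φ (d := d) Lc α) (V κ' u + conjV (bhK (d := d) Lc + Dsh)
        ((((Lc : ℝ) ^ (d + 1))⁻¹) • diagK (ctGenM d (bhK Lc + Dsh) α Lc κ' u)))) x z (Sum.inl β) (Sum.inr μ))
    (hVmf : ∀ (κ' : Fin (d + 1)) (u x z : Fin (d + 1) → ℤ) (μ β : Fin (d + 1)), V κ' (bref α κ' u) x z (Sum.inr μ) (Sum.inl β) =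
      (reflSign α κ' • refK (Φ (d := d) Lc α) (V κ' u + conjV (bhK (d := d) Lc + Dsh)
        ((((Lc : ℝ) ^ (d + 1))⁻¹) • diagK (ctGenM d (bhK Lc + Dsh) α Lc κ' u)))) x z (Sum.inr μ) (Sum.inl β))
    (hVmm : ∀ (κ' : Fin (d + 1)) (u x z : Fin (d + 1) → ℤ) (μ μ' : Fin (d + 1)), V κ' (bref α κ' u) x z (Sum.inr μ) (Sum.inr μ') =
      (reflSign α κ' • refK (Φ (d := d) Lc α) (V κ' u + conjV (bhK (d := d) Lc + Dsh)
        ((((Lc : ℝ) ^ (d + 1))⁻¹) • diagK (ctGenM d (bhK Lc + Dsh) α Lc κ' u)))) x z (Sum.inr μ) (Sum.inr μ'))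
    (hV0 : ∀ (κ : Fin (d + 1)) (w x z : Fin (d + 1) → ℤ) (β β' : Fin (d + 1)), V κ w x z (Sum.inl β) (Sum.inl β') = 0)
    (hHr : ∀ (α' μ : Fin (d + 1)) (y : Fin (d + 1) → ℤ), H μ (bref α' μ y) = reflSign α' μ • refK (Φ (d := d) Lc α') (H μ y)) :
    ∀ (j : ℕ) (κ : Fin (d + 1)) (u : Fin (d + 1) → ℤ),
      SrecOf d Lc V H (Gsym Lc) ((Lc : ℝ) ^ (d + 1)) (-((Lc : ℝ) ^ (d + 1) * (1 / 2) * (Lc : ℝ) ^ (d + 1))) cΛ j κ (bref α κ u) =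
        reflSign α κ • refK (Φ Lc α) (SrecOf d Lc V H (Gsym Lc) ((Lc : ℝ) ^ (d + 1)) (-((Lc : ℝ) ^ (d + 1) * (1 / 2) * (Lc : ℝ) ^ (d + 1))) cΛ j κ u +
          conjV (bhKStepSh d Lc Dsh j) ((-((Lc : ℝ) ^ (d + 1) * (1 / 2) * (Lc : ℝ) ^ (d + 1)) * wVH d Lc j / (stepScale d Lc j * (Lc : ℝ) ^ (d + 1))) •
            diagK (ctGenM d (bhK Lc + Dsh) α Lc κ u))) := by
  refine hSrC_SrecOf_Gsym_all hLc hV hH hD hDnull hDff hDmm hGD hDG ((Lc : ℝ) ^ (d + 1)) (-((Lc : ℝ) ^ (d + 1) * (1 / 2) * (Lc : ℝ) ^ (d + 1))) cΛ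
    (by ring) (fun j => (-((Lc : ℝ) ^ (d + 1) * (1 / 2) * (Lc : ℝ) ^ (d + 1))) * wVH d Lc j / (stepScale d Lc j * (Lc : ℝ) ^ (d + 1))) (fun j => rfl)
    (fun j => ?_) hVfm hVmf hVmm hV0 hHr
  have h := locks_of_pin (d := d) (Lc := Lc) ((Lc : ℝ) ^ (d + 1)) (-((Lc : ℝ) ^ (d + 1) * (1 / 2) * (Lc : ℝ) ^ (d + 1))) (pin_of_bcj _ rfl) j
  rw [show (-((Lc : ℝ) ^ (d + 1) * (1 / 2) * (Lc : ℝ) ^ (d + 1))) * wVH d Lc j / (stepScale d Lc j * (Lc : ℝ) ^ (d + 1)) /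
      (stepScale d Lc j * (Lc : ℝ) ^ (d + 1)) * (wVH d Lc (j + 1))⁻¹ =
    (-((Lc : ℝ) ^ (d + 1) * (1 / 2) * (Lc : ℝ) ^ (d + 1))) * wVH d Lc j / (stepScale d Lc j * (Lc : ℝ) ^ (d + 1)) /
      (stepScale d Lc j * (Lc : ℝ) ^ (d + 1)) * (wVH d Lc (j + 1))⁻¹ by rfl] at h
  rw [← h]

end Induction

/-! ## §5 `d + 1 = 4`: the (Sr-conj) letter of the literal at every level -/

section Literal

variable {Dsh : MKer 4 (Fib 3)}

/-- [folklore] **(Sr-conj) FOR THE LITERAL'S FIRST-ORDER TABLES `SsymOf tabs Lc⁴ (−Lc⁸∕2) cΛ` AT EVERY LEVEL** (`d + 1 = 4`, the pins of record). -/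
theorem hSrC_SsymOf_all {Lc : ℕ} [NeZero Lc] (hLc : Odd Lc) (tabs : SymTables 3 Lc) (cΛ : ℝ) {Dsh : MKer 4 (Fib 3)} (hD : Spr Dsh)
    (hDnull : comp (comp (symEc Lc) Dsh) (symEc Lc) = 0)
    (hDff : ∀ (x z : Fin 4 → ℤ) (β β' : Fin 4), Dsh x z (Sum.inl β) (Sum.inl β') = 0)
    (hDmm : ∀ (x y : Fin 4 → ℤ) (κ l : Fin 4), Dsh x y (Sum.inr κ) (Sum.inr l) = 0)
    (hGD : ∀ (j : ℕ) (x z : Fin 4 → ℤ) (m a : Fin 4), comp (Gsym (d := 3) Lc j) Dsh x z (Sum.inr m) (Sum.inl a) = 0)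
    (hDG : ∀ (j : ℕ) (x z : Fin 4 → ℤ) (a m : Fin 4), comp Dsh (Gsym (d := 3) Lc j) x z (Sum.inl a) (Sum.inr m) = 0)
    {α : Fin 4}
    (hVfm : ∀ (κ' : Fin 4) (u x z : Fin 4 → ℤ) (β μ : Fin 4), tabs.V κ' (bref α κ' u) x z (Sum.inl β) (Sum.inr μ) =
      (reflSign α κ' • refK (Φ (d := 3) Lc α) (tabs.V κ' u + conjV (bhK (d := 3) Lc + Dsh)
        ((((Lc : ℝ) ^ 4)⁻¹) • diagK (ctGenM 3 (bhK Lc + Dsh) α Lc κ' u)))) x z (Sum.inl β) (Sum.inr μ))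
    (hVmf : ∀ (κ' : Fin 4) (u x z : Fin 4 → ℤ) (μ β : Fin 4), tabs.V κ' (bref α κ' u) x z (Sum.inr μ) (Sum.inl β) =
      (reflSign α κ' • refK (Φ (d := 3) Lc α) (tabs.V κ' u + conjV (bhK (d := 3) Lc + Dsh)
        ((((Lc : ℝ) ^ 4)⁻¹) • diagK (ctGenM 3 (bhK Lc + Dsh) α Lc κ' u)))) x z (Sum.inr μ) (Sum.inl β))
    (hVmm : ∀ (κ' : Fin 4) (u x z : Fin 4 → ℤ) (μ μ' : Fin 4), tabs.V κ' (bref α κ' u) x z (Sum.inr μ) (Sum.inr μ') =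
      (reflSign α κ' • refK (Φ (d := 3) Lc α) (tabs.V κ' u + conjV (bhK (d := 3) Lc + Dsh)
        ((((Lc : ℝ) ^ 4)⁻¹) • diagK (ctGenM 3 (bhK Lc + Dsh) α Lc κ' u)))) x z (Sum.inr μ) (Sum.inr μ'))
    (hV0 : ∀ (κ : Fin 4) (w x z : Fin 4 → ℤ) (β β' : Fin 4), tabs.V κ w x z (Sum.inl β) (Sum.inl β') = 0)
    (hHr : ∀ (α' μ : Fin 4) (y : Fin 4 → ℤ), tabs.H μ (bref α' μ y) = reflSign α' μ • refK (Φ (d := 3) Lc α') (tabs.H μ y)) :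
    ∀ (j : ℕ) (κ : Fin 4) (u : Fin 4 → ℤ),
      SsymOf tabs ((Lc : ℝ) ^ 4) (-((Lc : ℝ) ^ 4 * (1 / 2) * (Lc : ℝ) ^ 4)) cΛ j κ (bref α κ u) =
        reflSign α κ • refK (Φ Lc α) (SsymOf tabs ((Lc : ℝ) ^ 4) (-((Lc : ℝ) ^ 4 * (1 / 2) * (Lc : ℝ) ^ 4)) cΛ j κ u +
          conjV (bhKStepSh 3 Lc Dsh j) ((-((Lc : ℝ) ^ 4 * (1 / 2) * (Lc : ℝ) ^ 4) * wVH 3 Lc j / (stepScale 3 Lc j * (Lc : ℝ) ^ 4)) •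
            diagK (ctGenM 3 (bhK Lc + Dsh) α Lc κ u))) := by
  rw [SsymOf_eq]
  exact hSrC_SrecOf_Gsym_all_bcj (d := 3) hLc tabs.hV tabs.hH hD hDnull hDff hDmm hGD hDG cΛ hVfm hVmf hVmm hV0 hHr

/-- [folklore] **(Sr-conj) FOR THE (0.4) LITERAL `JsB12Sym0 hLc N tabs cΛ cB` AT EVERY LEVEL** — the hypothesis hSrC of the row's END at the literal
(`RowD1JointEndSym.d1Drift_JsB12Sym_of_shiftLetters_D1Tel_D1Rep`) with `C j α κ u := γ j • diagK (ctGenM 3 (bhK Lc + Dsh) α Lc κ u)`, `γ j = −(Lc⁸∕2)·wVH 3 Lc j∕(stepScale 3 Lc j·Lc⁴)`,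
from the letters (Dspr)(Dnull)(Dff)(Dmm)(DG)(V-r)(V-ff0)(H-r) and NOTHING ELSE. -/
theorem hSrC_JsB12Sym0 {Lc : ℕ} [NeZero Lc] (hLc : Odd Lc) (N : ℕ) (tabs : SymTables 3 Lc) (cΛ cB : ℝ) {Dsh : MKer 4 (Fib 3)} (hD : Spr Dsh)
    (hDnull : comp (comp (symEc Lc) Dsh) (symEc Lc) = 0)
    (hDff : ∀ (x z : Fin 4 → ℤ) (β β' : Fin 4), Dsh x z (Sum.inl β) (Sum.inl β') = 0)
    (hDmm : ∀ (x y : Fin 4 → ℤ) (κ l : Fin 4), Dsh x y (Sum.inr κ) (Sum.inr l) = 0)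
    (hGD : ∀ (j : ℕ) (x z : Fin 4 → ℤ) (m a : Fin 4), comp (Gsym (d := 3) Lc j) Dsh x z (Sum.inr m) (Sum.inl a) = 0)
    (hDG : ∀ (j : ℕ) (x z : Fin 4 → ℤ) (a m : Fin 4), comp Dsh (Gsym (d := 3) Lc j) x z (Sum.inl a) (Sum.inr m) = 0)
    {α : Fin 4}
    (hVfm : ∀ (κ' : Fin 4) (u x z : Fin 4 → ℤ) (β μ : Fin 4), tabs.V κ' (bref α κ' u) x z (Sum.inl β) (Sum.inr μ) =
      (reflSign α κ' • refK (Φ (d := 3) Lc α) (tabs.V κ' u + conjV (bhK (d := 3) Lc + Dsh)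
        ((((Lc : ℝ) ^ 4)⁻¹) • diagK (ctGenM 3 (bhK Lc + Dsh) α Lc κ' u)))) x z (Sum.inl β) (Sum.inr μ))
    (hVmf : ∀ (κ' : Fin 4) (u x z : Fin 4 → ℤ) (μ β : Fin 4), tabs.V κ' (bref α κ' u) x z (Sum.inr μ) (Sum.inl β) =
      (reflSign α κ' • refK (Φ (d := 3) Lc α) (tabs.V κ' u + conjV (bhK (d := 3) Lc + Dsh)
        ((((Lc : ℝ) ^ 4)⁻¹) • diagK (ctGenM 3 (bhK Lc + Dsh) α Lc κ' u)))) x z (Sum.inr μ) (Sum.inl β))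
    (hVmm : ∀ (κ' : Fin 4) (u x z : Fin 4 → ℤ) (μ μ' : Fin 4), tabs.V κ' (bref α κ' u) x z (Sum.inr μ) (Sum.inr μ') =
      (reflSign α κ' • refK (Φ (d := 3) Lc α) (tabs.V κ' u + conjV (bhK (d := 3) Lc + Dsh)
        ((((Lc : ℝ) ^ 4)⁻¹) • diagK (ctGenM 3 (bhK Lc + Dsh) α Lc κ' u)))) x z (Sum.inr μ) (Sum.inr μ'))
    (hV0 : ∀ (κ : Fin 4) (w x z : Fin 4 → ℤ) (β β' : Fin 4), tabs.V κ w x z (Sum.inl β) (Sum.inl β') = 0)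
    (hHr : ∀ (α' μ : Fin 4) (y : Fin 4 → ℤ), tabs.H μ (bref α' μ y) = reflSign α' μ • refK (Φ (d := 3) Lc α') (tabs.H μ y)) :
    ∀ (j : ℕ) (κ : Fin 4) (u : Fin 4 → ℤ),
      (JsB12Sym0 hLc N tabs cΛ cB j).S κ (bref α κ u) =
        reflSign α κ • refK (Φ Lc α) ((JsB12Sym0 hLc N tabs cΛ cB j).S κ u +
          conjV (bhKStepSh 3 Lc Dsh j) ((-((Lc : ℝ) ^ 8 / 2) * wVH 3 Lc j / (stepScale 3 Lc j * (Lc : ℝ) ^ 4)) •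
            diagK (ctGenM 3 (bhK Lc + Dsh) α Lc κ u))) := by
  intro j κ u
  have h := hSrC_SsymOf_all hLc tabs cΛ hD hDnull hDff hDmm hGD hDG hVfm hVmf hVmm hV0 hHr j κ u
  have e : -((Lc : ℝ) ^ 4 * (1 / 2) * (Lc : ℝ) ^ 4) = -((Lc : ℝ) ^ 8 / 2) := by ring
  rw [e] at h
  rw [JsB12Sym0_eq, JsSym0Of_S]
  exact h

end Literal

end Summit.QuantumFields.BalabanUV.Beta.ReflectionLocusSymShift

end
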